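import Summits.HodgeConjecture.HodgeConjecture.Theorems.MarkmanPartnerTransportPicardThreeK3SquaresQuotientSimilitude
import Summits.HodgeConjecture.HodgeConjecture.Theorems.MarkmanPartnerTransportPicardThreeK3SquaresSqrtSix

/-!
# Route MarkmanPartnerTransport · crux `PicardThreeK3Squares` (stmt-HodgeConjecture-19652) —
# Varesco's theorem in the kernel: rational Hodge SIMILITUDES of multiplier `2` (resp. `3`) onto `T(X)`,
# `ρ(X) ≥ 11` (resp. `≥ 15`), between projective K3 surfaces are algebraic

Companion of `…QuotientSimilitude` (the case `Y = X`). Varesco (Math. Z. 305 (2023), Thm. 0.2 / §2)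
proves: a Hodge similarity `ψ : T(Y)_ℚ ⥲ T(X)_ℚ` of multiplier `p` between K3 surfaces is algebraic as
soon as `X` is Hodge isometric to a K3 surface with a symplectic automorphism of order `p` — because the
quotient construction gives an ALGEBRAIC similitude `φ : T(Z) ⥲ T(X)` of multiplier `p`, and
`φ⁻¹ ∘ ψ = c⁻¹·ᵗφ ∘ ψ : T(Y) ⥲ T(Z)` is then a rational Hodge ISOMETRY, algebraic by Buskin–Huybrechts.
Here this is carried out on the tree's real carriers, with the geometric input isolated as the DATUM
`(Z, γ)` (for `p ∈ {2,3}` the named facts `Varesco2023_quotientSimilitude_two/three_of_transcendental_embedding`,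
whose lattice hypotheses are automatic at `ρ(X) ≥ 11` resp. `≥ 15` by Kitaoka).

* `algebraic_of_similitude_of_datum` — marked `X`, `Y`; a datum `(Z, γ)` for `X` of multiplier `m ≠ 0`;
  `ψ : H²(Y) → H²(X)` mapping `T(Y)` onto `T(X)`, rational there, multiplier `m` in the markings, carrying
  the period line of `Y` into that of `X` ⟹ `ψ = [γ']_*` on `T(Y)` for an algebraic `γ'` on `X ⊗ Y`,
  modulo `Buskin2019_hodgeIsometry_algebraic` only.
* `algebraic_of_similitude_two_of_eleven_le`, `algebraic_of_similitude_three_of_fifteen_le` — **every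
  rational Hodge similitude of multiplier `2` (resp. `3`) from `T(Y)` onto `T(X)`, `X`, `Y` marked projective
  K3 surfaces with `ρ(X) ≥ 11` (resp. `≥ 15`), is induced on `T(Y)` by an algebraic class on `X ⊗ Y`**,
  modulo Buskin and the quotient fact. Consequence (with `…IsogenyInvariance`): HC⁴(S ⊗ S) is an invariant
  of such similitude classes, not only of isogeny classes.

No definition, no sorry. Prover seat hodge-nonav-19652-p1 (gen 5), `--supports stmt-HodgeConjecture-19652`.

References: M. Varesco, Math. Z. 305 (2023) art. 69, Thm. 0.2, §2 (starting observation), Thm. 2.1,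
Prop. 2.5, Prop. 2.11; N. Buskin, J. reine angew. Math. 755 (2019) Thm. 1.1; D. Huybrechts, Comment.
Math. Helv. 94 (2019) Cor. 0.4 (i); B. Kahn, *Zeta and L-functions of varieties and motives*, Lemma 3.48.
-/

set_option linter.dupNamespace false

noncomputable section

namespace Summit.HodgeConjecture.HodgeConjecture.Theorems.MarkmanPartnerTransport.QuotientSimilitude

open scoped Manifold
open Module CategoryTheory MonoidalCategory CartesianMonoidalCategory
open Literature.AlgebraicGeometry Literature.AlgebraicGeometry.Motives Literature.AlgebraicGeometry.HodgeTheory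
open Literature.AlgebraicGeometry.Surfaces
open Literature.AlgebraicTopology.SingularHomology
open Summit.HodgeConjecture.HodgeConjecture.Theorems
open Summit.HodgeConjecture.HodgeConjecture.Theorems.NikulinTwinTransport
open Summit.HodgeConjecture.HodgeConjecture.Theorems.NikulinTwinTransport.SquareGlueFree
open Summit.HodgeConjecture.HodgeConjecture.Theorems.MarkmanPartnerTransport
open Summit.HodgeConjecture.HodgeConjecture.Theorems.MarkmanPartnerTransport.SimilitudeTranspose

variable {S : SchemeOver ℂ}

/-- `MarkedK3[S, η, p, x]`: VERBATIM the `let MarkedK3 := …` binder of the route declaration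
`PicardThreeK3Squares`. Local notation only. -/
local notation3 (prettyPrint := false) "MarkedK3[" S ", " η ", " p ", " x "]" =>
  (p ≠ 0 ∧ (IsIntegralClass p ∧
    (∀ q : complexBetti S (2 * 2), IsIntegralClass q → ∃ n : ℤ, q = n • p) ∧
    (∀ c : complexBetti S (2 * 1), IsIntegralClass c ↔ ∃ v : K3Index → ℤ, η c = fun i => (v i : ℂ)) ∧
    (∀ a b : complexBetti S (2 * 1),
      cupProduct (rfl : 2 * 1 + 2 * 1 = 2 * 2) a b = k3Form (η a) (η b) • p) ∧
    IsOfHodgeType 2 S (2 * 1) 2 0 (LinearEquiv.symm η x) ∧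
    (∀ τ : complexBetti S (2 * 1), IsOfHodgeType 2 S (2 * 1) 2 0 τ →
      ∃ t : ℂ, τ = t • LinearEquiv.symm η x)) ∧
    (k3Form x x = 0 ∧ 0 < (k3Form (star x) x).re ∧
      ∃ u : K3Index → ℤ, k3Form (fun i => (u i : ℂ)) x = 0 ∧ 0 < ∑ i, ∑ j, u i * k3Gram i j * u j))

/-- `Corr[μ, X, Y, hX, hY ; γ, y] = fst_* (snd^* y ∪ γ)` (`hX hY : IsSmoothProjective 2 _`). Local notation only. -/
local notation3 (prettyPrint := false) "Corr[" μ ", " X ", " Y ", " hX ", " hY " ; " γ ", " y "]" =>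
  complexGysin μ (IsSmoothProjective.tensor_holds hX hY) hX (SemiCartesianMonoidalCategory.fst X Y)
    (rfl : 2 * 1 + 2 * 2 + 2 * 2 = 2 * 1 + 2 * (2 + 2))
    (cupProduct (rfl : 2 * 1 + 2 * 2 = 2 * 1 + 2 * 2)
      (complexBetti.map (SemiCartesianMonoidalCategory.snd X Y) (2 * 1) y) γ)

/-- `Transp[X, Y ; γ] = swap^* γ`. Local notation only. -/
local notation3 (prettyPrint := false) "Transp[" X ", " Y " ; " γ "]" =>
  complexBetti.map (CartesianMonoidalCategory.lift (SemiCartesianMonoidalCategory.snd Y X)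
    (SemiCartesianMonoidalCategory.fst Y X)) (2 * 2) γ

/-- `Datum[X, Z, hX, hZ, η, ηZ ; γ, m]`: `γ` is an algebraic class on `X ⊗ Z` whose action `[γ]_*`
(complex orientations) is rational, Hodge-type preserving, maps `T(Z)` onto `T(X)` and scales the forms by
`m` there in the markings `η`, `η_Z` — the conclusion of `Varesco2023_quotientSimilitude_…` in the `Corr`
spelling. Local notation only. -/
local notation3 (prettyPrint := false) "Datum[" X ", " Z ", " hX ", " hZ ", " η ", " ηZ " ; " γ ", " m "]" =>
  (γ ∈ algebraicClasses (X ⊗ Z) 2 ∧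
    (∀ y, IsRationalClass y → IsRationalClass (Corr[complexOrientationFamily, X, Z, hX, hZ ; γ, y])) ∧
    (∀ (i j : ℕ) y, IsOfHodgeType 2 Z (2 * 1) i j y →
      IsOfHodgeType 2 X (2 * 1) i j (Corr[complexOrientationFamily, X, Z, hX, hZ ; γ, y])) ∧
    (∀ y ∈ transcendentalSubspace Z,
      Corr[complexOrientationFamily, X, Z, hX, hZ ; γ, y] ∈ transcendentalSubspace X) ∧
    (∀ z ∈ transcendentalSubspace X, ∃ y ∈ transcendentalSubspace Z,
      Corr[complexOrientationFamily, X, Z, hX, hZ ; γ, y] = z) ∧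
    (∀ a ∈ transcendentalSubspace Z, ∀ b ∈ transcendentalSubspace Z,
      k3Form (η (Corr[complexOrientationFamily, X, Z, hX, hZ ; γ, a]))
        (η (Corr[complexOrientationFamily, X, Z, hX, hZ ; γ, b])) = (m : ℂ) * k3Form (ηZ a) (ηZ b)))

/-! ### The general theorem -/

/-- **Varesco's theorem, abstract form: a rational Hodge similitude onto `T(X)` whose multiplier is that
of an algebraic similitude datum for `X` is algebraic.** Let `(X, η, p, x)`, `(Y, η_Y, p_Y, x_Y)`,
`(Z, η_Z, p_Z, x_Z)` be marked projective K3 surfaces, `γ` a datum for `X` from `Z` of multiplier `m ≠ 0`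
(`Datum`), and `ψ : H²(Y(ℂ); ℂ) → H²(X(ℂ); ℂ)` a map sending `T(Y)` onto `T(X)`, rational there, with
`(ηψa · ηψb) = m (η_Y a · η_Y b)` on `T(Y)` and `ψ(η_Y⁻¹x_Y) ∈ ℂ·η⁻¹x`. Then, granted
`Buskin2019_hodgeIsometry_algebraic`, `ψ = [γ']_*` on `T(Y)` for an algebraic class `γ'` on `X ⊗ Y`. Proof:
`u = c⁻¹·ᵗφ ∘ ψ : T(Y) ⥲ T(Z)` (`φ = [γ]_*`, `φᵗφ = c` on `T(X)`, `ᵗφφ = c` on `T(Z)`) is a rational Hodge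
isometry, so `u = [γ_u]_*` (Buskin–Huybrechts), and `ψ = φ ∘ u = [γ ∘ γ_u]_*` on `T(Y)`.
[cite: Varesco2023, Thm. 0.2 and §2 Thm. 2.1 (proof)] [cite: Huybrechts2019, Cor. 0.4 (i)]
[cite: Kahn2020, §3.5.3 Lemma 3.48] -/
theorem algebraic_of_similitude_of_datum (hB : Buskin2019_hodgeIsometry_algebraic)
    (hS : IsK3Surface S)
    (η : complexBetti S (2 * 1) ≃ₗ[ℂ] (K3Index → ℂ)) (p : complexBetti S (2 * 2)) (x : K3Index → ℂ)
    (hM : MarkedK3[S, η, p, x])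
    {Y : SchemeOver ℂ} (hY : IsK3Surface Y)
    (ηY : complexBetti Y (2 * 1) ≃ₗ[ℂ] (K3Index → ℂ)) (pY : complexBetti Y (2 * 2)) (xY : K3Index → ℂ)
    (hMY : MarkedK3[Y, ηY, pY, xY])
    {Z : SchemeOver ℂ} (hZ : IsK3Surface Z)
    (ηZ : complexBetti Z (2 * 1) ≃ₗ[ℂ] (K3Index → ℂ)) (pZ : complexBetti Z (2 * 2)) (xZ : K3Index → ℂ)
    (hMZ : MarkedK3[Z, ηZ, pZ, xZ])
    {m : ℕ} (hm : m ≠ 0) (γ : complexBetti (S ⊗ Z) (2 * 2)) (hD : Datum[S, Z, hS.1, hZ.1, η, ηZ ; γ, m])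
    (ψ : complexBetti Y (2 * 1) →ₗ[ℂ] complexBetti S (2 * 1))
    (hψT : ∀ y ∈ transcendentalSubspace Y, ψ y ∈ transcendentalSubspace S)
    (hψonto : ∀ z ∈ transcendentalSubspace S, ∃ y ∈ transcendentalSubspace Y, ψ y = z)
    (hψrat : ∀ y ∈ transcendentalSubspace Y, IsRationalClass y → IsRationalClass (ψ y))
    (hψmul : ∀ a ∈ transcendentalSubspace Y, ∀ b ∈ transcendentalSubspace Y,
      k3Form (η (ψ a)) (η (ψ b)) = (m : ℂ) * k3Form (ηY a) (ηY b))
    (hψline : ∃ t : ℂ, ψ (ηY.symm xY) = t • η.symm x) :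
    ∃ γ' ∈ algebraicClasses (S ⊗ Y) 2, ∀ y ∈ transcendentalSubspace Y,
      Corr[complexOrientationFamily, S, Y, hS.1, hY.1 ; γ', y] = ψ y := by
  classical
  have h4 : 2 * 1 + 2 * 1 = 2 * 2 := rfl
  have hm0 : (m : ℂ) ≠ 0 := Nat.cast_ne_zero.2 hm
  obtain ⟨hp₀, ⟨hpint, hpgen, hηint, hηcup, hx20, hxline⟩, -⟩ := id hM
  obtain ⟨hpZ0, ⟨hpZint, -, -, hηZcup, hxZ20, hxZline⟩, -⟩ := id hMZ
  obtain ⟨hγalg, hφrat, hφtyp, hφT, hφonto, hφmul⟩ := hD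
  -- `φ` and its transpose as linear maps
  set φ : complexBetti Z (2 * 1) →ₗ[ℂ] complexBetti S (2 * 1) :=
    (complexGysin complexOrientationFamily (IsSmoothProjective.tensor_holds hS.1 hZ.1) hS.1
        (SemiCartesianMonoidalCategory.fst S Z) (rfl : 2 * 1 + 2 * 2 + 2 * 2 = 2 * 1 + 2 * (2 + 2))) ∘ₗ
      ((cupProduct (rfl : 2 * 1 + 2 * 2 = 2 * 1 + 2 * 2)).flip γ) ∘ₗ
      (complexBetti.map (SemiCartesianMonoidalCategory.snd S Z) (2 * 1)).hom with hφdef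
  have hφ : ∀ y, φ y = Corr[complexOrientationFamily, S, Z, hS.1, hZ.1 ; γ, y] := fun y ↦ rfl
  set φt : complexBetti S (2 * 1) →ₗ[ℂ] complexBetti Z (2 * 1) :=
    (complexGysin complexOrientationFamily (IsSmoothProjective.tensor_holds hZ.1 hS.1) hZ.1
        (SemiCartesianMonoidalCategory.fst Z S) (rfl : 2 * 1 + 2 * 2 + 2 * 2 = 2 * 1 + 2 * (2 + 2))) ∘ₗ
      ((cupProduct (rfl : 2 * 1 + 2 * 2 = 2 * 1 + 2 * 2)).flip (Transp[S, Z ; γ])) ∘ₗ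
      (complexBetti.map (SemiCartesianMonoidalCategory.snd Z S) (2 * 1)).hom with hφtdef
  have hφt : ∀ w, φt w = Corr[complexOrientationFamily, Z, S, hZ.1, hS.1 ; Transp[S, Z ; γ], w] :=
    fun w ↦ rfl
  have hφtyp' : ∀ y, IsOfHodgeType 2 Z (2 * 1) 1 1 y →
      IsOfHodgeType 2 S (2 * 1) 1 1 (Corr[complexOrientationFamily, S, Z, hS.1, hZ.1 ; γ, y]) :=
    fun y hy ↦ hφtyp 1 1 y hy
  -- the constant `c = m · ∫p_X / ∫p_Z`, rational and non-zero
  set c : ℂ := (m : ℂ) * traceC hS.1 p * (traceC hZ.1 pZ)⁻¹ with hcdef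
  have hτS : traceC hS.1 p ≠ 0 := fun h ↦ hp₀ (eq_zero_of_traceC_eq_zero hS.1 h)
  have hτZ : traceC hZ.1 pZ ≠ 0 := fun h ↦ hpZ0 (eq_zero_of_traceC_eq_zero hZ.1 h)
  have hc0 : c ≠ 0 := by
    rw [hcdef]
    exact mul_ne_zero (mul_ne_zero hm0 hτS) (inv_ne_zero hτZ)
  obtain ⟨p₀, hp₀eq⟩ := (isRationalClass_iff_mem_range_ofRatClass _).1 hpint.isRationalClass
  obtain ⟨pZ₀, hpZ₀eq⟩ := (isRationalClass_iff_mem_range_ofRatClass _).1 hpZint.isRationalClass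
  set κ : ℚ := ((m : ℚ) * trace hS.1 p₀ * (trace hZ.1 pZ₀)⁻¹)⁻¹ with hκdef
  have hκ : (κ : ℂ) = c⁻¹ := by
    rw [hκdef, hcdef, ← hp₀eq, ← hpZ₀eq, traceC_ofRatClass, traceC_ofRatClass]
    push_cast
    rfl
  -- `φ ᵗφ = c` on `T(X)`, `ᵗφ φ = c` on `T(Z)`; `ᵗφ` maps `T(X) → T(Z)`, rational
  have key : ∀ z ∈ transcendentalSubspace S, φ (φt z) = c • z := fun z hz ↦ by
    rw [hφt, hφ]
    exact comp_transpose_eq_smul hS.1 hZ.1 η p ηZ pZ hpZ0 hηcup hηZcup γ hφrat hφtyp' hφT hφonto hφmul hz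
  have key' : ∀ y ∈ transcendentalSubspace Z, φt (φ y) = c • y := fun y hy ↦ by
    rw [hφt, hφ]
    exact transpose_comp_eq_smul hS.1 hZ.1 η p ηZ pZ hpZ0 hηcup hηZcup γ hφrat hφtyp' hφT hφmul hy
  have hφtT : ∀ z ∈ transcendentalSubspace S, φt z ∈ transcendentalSubspace Z := fun z hz ↦ by
    rw [hφt]
    exact transpose_mem_transcendentalSubspace hS.1 hZ.1 γ hφrat hφtyp' hz
  have hφtrat : ∀ z, IsRationalClass z → IsRationalClass (φt z) := fun z hz ↦ by
    rw [hφt]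
    exact isRationalClass_transpose hS.1 hZ.1 γ hφrat hz
  -- multiplier of `ᵗφ` on `T(X)`: `m (ηZ ᵗφa · ηZ ᵗφb) = c² (ηa · ηb)`
  have hφtmul : ∀ a ∈ transcendentalSubspace S, ∀ b ∈ transcendentalSubspace S,
      (m : ℂ) * k3Form (ηZ (φt a)) (ηZ (φt b)) = c ^ 2 * k3Form (η a) (η b) := by
    intro a ha b hb
    have h := hφmul _ (hφtT a ha) _ (hφtT b hb)
    rw [← hφ, ← hφ, key a ha, key b hb, map_smul, map_smul, k3Form_smul_left, k3Form_smul_right] at h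
    linear_combination -h
  -- the Hodge isometry `u = c⁻¹ · ᵗφ ∘ ψ : H²(Y) → H²(Z)`
  set u : complexBetti Y (2 * 1) →ₗ[ℂ] complexBetti Z (2 * 1) := c⁻¹ • (φt ∘ₗ ψ) with hudef
  have hu : ∀ y, u y = c⁻¹ • φt (ψ y) := fun y ↦ rfl
  have huT : ∀ y ∈ transcendentalSubspace Y, u y ∈ transcendentalSubspace Z := fun y hy ↦ by
    rw [hu]
    exact Submodule.smul_mem _ _ (hφtT _ (hψT y hy))
  have huonto : ∀ z ∈ transcendentalSubspace Z, ∃ y ∈ transcendentalSubspace Y, u y = z := by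
    intro z hz
    obtain ⟨y, hy, hyz⟩ := hψonto (φ z) (by rw [hφ]; exact hφT z hz)
    refine ⟨y, hy, ?_⟩
    rw [hu, hyz, key' z hz, smul_smul, inv_mul_cancel₀ hc0, one_smul]
  have hurat : ∀ y ∈ transcendentalSubspace Y, IsRationalClass y → IsRationalClass (u y) := by
    intro y hyT hy
    rw [hu, ← hκ]
    exact (hφtrat _ (hψrat y hyT hy)).smul _
  have huiso : ∀ a ∈ transcendentalSubspace Y, ∀ b ∈ transcendentalSubspace Y,
      k3Form (ηZ (u a)) (ηZ (u b)) = k3Form (ηY a) (ηY b) := by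
    intro a ha b hb
    have h1 := hφtmul _ (hψT a ha) _ (hψT b hb)
    rw [hψmul a ha b hb] at h1
    have h2 : (m : ℂ) * k3Form (ηZ (φt (ψ a))) (ηZ (φt (ψ b))) = (m : ℂ) * (c ^ 2 * k3Form (ηY a) (ηY b)) := by
      rw [h1]; ring
    have h3 := mul_left_cancel₀ hm0 h2
    rw [hu, hu, map_smul, map_smul, k3Form_smul_left, k3Form_smul_right, h3]
    field_simp
  -- the period line
  have hωZT : ηZ.symm xZ ∈ transcendentalSubspace Z :=
    (mem_transcendentalSubspace_iff_forall_algebraicClasses hZ.1 _).2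
      fun d hd ↦ PgOneCyclotomicSquares.cup_eq_zero_of_twoZero hZ.1 hxZ20 hd
  have hωZne : ηZ.symm xZ ≠ 0 := CyclotomicCM.period_ne_zero hMZ
  have huline : ∃ t : ℂ, u (ηY.symm xY) = t • ηZ.symm xZ := by
    obtain ⟨t, ht⟩ := hψline
    -- `φ (ηZ⁻¹xZ) = s • η⁻¹x` with `s ≠ 0`, so `ᵗφ (η⁻¹x) = (s⁻¹ c) • ηZ⁻¹xZ`
    have h20 : IsOfHodgeType 2 S (2 * 1) 2 0 (φ (ηZ.symm xZ)) := by rw [hφ]; exact hφtyp 2 0 _ hxZ20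
    obtain ⟨s, hs⟩ := hxline _ h20
    have hs0 : s ≠ 0 := by
      rintro rfl
      rw [zero_smul] at hs
      have h := key' _ hωZT
      rw [hs, map_zero] at h
      exact hωZne (by
        have := h.symm
        rwa [smul_eq_zero, or_iff_right hc0] at this)
    have hline : φt (η.symm x) = (s⁻¹ * c) • ηZ.symm xZ := by
      have h := key' _ hωZT
      rw [hs, map_smul] at h
      rw [mul_smul, ← h, smul_smul, inv_mul_cancel₀ hs0, one_smul]
    refine ⟨c⁻¹ * (t * (s⁻¹ * c)), ?_⟩
    rw [hu, ht, map_smul, hline, smul_smul, smul_smul, mul_assoc]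
  -- Buskin–Huybrechts on `u : T(Y) ⥲ T(Z)`
  have hH : Huybrechts2019_transcendentalHodgeIsometry_algebraic :=
    NikulinIsogeny.transcendentalHodgeIsometry_algebraic_of_buskin hB
  obtain ⟨γu, hγualg, hγu⟩ := hH hZ hY ηZ pZ xZ ηY pY xY hMZ hMY u huT huonto hurat huiso huline
  -- `ψ = φ ∘ u = [γ ∘ γ_u]_*` on `T(Y)`
  have hCUP := SquareOfGenerator.cupProduct_mem_algebraicClasses_tripleProduct
  obtain ⟨γ', hγ'alg, hγ'⟩ := corrComp_K3_of_cup complexOrientationFamily hCUP S Z Y hS hZ hY γ hγalg γu hγualg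
  refine ⟨γ', hγ'alg, fun y hy ↦ ?_⟩
  rw [hγ' y, ← hγu y hy, ← hφ, hu, map_smul, key _ (hψT y hy), smul_smul, inv_mul_cancel₀ hc0, one_smul]

/-! ### Multiplier `2` at `ρ(X) ≥ 11`, multiplier `3` at `ρ(X) ≥ 15` -/

/-- **Every rational Hodge similitude of multiplier `2` from `T(Y)` onto `T(X)` — `X`, `Y` marked
projective K3 surfaces, `ρ(X) ≥ 11` — is induced on `T(Y)` by an algebraic class on `X ⊗ Y`**, modulo
`Buskin2019_hodgeIsometry_algebraic` and `Varesco2023_quotientSimilitude_two_of_transcendental_embedding`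
(Varesco's Thm. 0.2 for `p = 2`; the hypothesis "`X` Hodge isometric to a K3 surface with a Nikulin
involution" is automatic at `dim T(X)_ℚ ≤ 11`, Prop. 2.5 with Kitaoka). [cite: Varesco2023, Thm. 0.2, Thm. 2.1 and Prop. 2.5]
[cite: Kitaoka1993, Ch. 4 Cor. 4.1.4] [cite: Buskin2019, Thm. 1.1] -/
theorem algebraic_of_similitude_two_of_eleven_le (hB : Buskin2019_hodgeIsometry_algebraic)
    (hQ2 : Varesco2023_quotientSimilitude_two_of_transcendental_embedding) (hS : IsK3Surface S)
    (η : complexBetti S (2 * 1) ≃ₗ[ℂ] (K3Index → ℂ)) (p : complexBetti S (2 * 2)) (x : K3Index → ℂ)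
    (hM : MarkedK3[S, η, p, x]) (hρ : 11 ≤ Module.finrank ℂ ↥(algebraicClasses S 1))
    {Y : SchemeOver ℂ} (hY : IsK3Surface Y)
    (ηY : complexBetti Y (2 * 1) ≃ₗ[ℂ] (K3Index → ℂ)) (pY : complexBetti Y (2 * 2)) (xY : K3Index → ℂ)
    (hMY : MarkedK3[Y, ηY, pY, xY])
    (ψ : complexBetti Y (2 * 1) →ₗ[ℂ] complexBetti S (2 * 1))
    (hψT : ∀ y ∈ transcendentalSubspace Y, ψ y ∈ transcendentalSubspace S)
    (hψonto : ∀ z ∈ transcendentalSubspace S, ∃ y ∈ transcendentalSubspace Y, ψ y = z)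
    (hψrat : ∀ y ∈ transcendentalSubspace Y, IsRationalClass y → IsRationalClass (ψ y))
    (hψmul : ∀ a ∈ transcendentalSubspace Y, ∀ b ∈ transcendentalSubspace Y,
      k3Form (η (ψ a)) (η (ψ b)) = 2 * k3Form (ηY a) (ηY b))
    (hψline : ∃ t : ℂ, ψ (ηY.symm xY) = t • η.symm x) :
    ∃ γ' ∈ algebraicClasses (S ⊗ Y) 2, ∀ y ∈ transcendentalSubspace Y,
      Corr[complexOrientationFamily, S, Y, hS.1, hY.1 ; γ', y] = ψ y := by
  obtain ⟨hp₀, ⟨hpint, hpgen, hηint, hηcup, -, -⟩, -⟩ := id hM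
  obtain ⟨ι, hiso, hinj⟩ := NikulinIsogeny.exists_transcendentalEmbedding_weightedSumSquares hS η p x hM
    (![1, 1, 1, -1, -1, -1, -1, -1, -1, -1, -1, -1, -1, -1] : Fin 14 → ℚ) SqrtSix.u3e8Weights_ne_zero
    (by rw [SqrtSix.ncard_u3e8Weights_pos]) (by rw [SqrtSix.ncard_u3e8Weights_neg]; omega) (by omega)
  obtain ⟨Z, hZ, ηZ, pZ, xZ, hMZ, φ, γ, hγalg, hφ, hφrat, hφtyp, hφT, hφonto, hφmul⟩ :=
    hQ2 hS η p hp₀ hpint hpgen hηint hηcup ι hiso hinj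
  refine algebraic_of_similitude_of_datum hB hS η p x hM hY ηY pY xY hMY hZ ηZ pZ xZ hMZ (m := 2) two_ne_zero γ
    ⟨hγalg, fun y hy ↦ by rw [← hφ]; exact hφrat y hy, fun i j y hy ↦ by rw [← hφ]; exact hφtyp i j y hy,
      fun y hy ↦ by rw [← hφ]; exact hφT y hy,
      fun z hz ↦ by
        obtain ⟨y, hy, hyz⟩ := hφonto z hz
        exact ⟨y, hy, by rw [← hφ]; exact hyz⟩,
      fun a ha b hb ↦ by rw [← hφ, ← hφ, Nat.cast_ofNat]; exact hφmul a ha b hb⟩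
    ψ hψT hψonto hψrat (fun a ha b hb ↦ by rw [Nat.cast_ofNat]; exact hψmul a ha b hb) hψline

/-- **Every rational Hodge similitude of multiplier `3` from `T(Y)` onto `T(X)` — `X`, `Y` marked
projective K3 surfaces, `ρ(X) ≥ 15` — is induced on `T(Y)` by an algebraic class on `X ⊗ Y`**, modulo
`Buskin2019_hodgeIsometry_algebraic` and `Varesco2023_quotientSimilitude_three_of_transcendental_embedding`
(Varesco's Thm. 0.2 for `p = 3`; "`X` Hodge isometric to a K3 surface with a symplectic automorphism of
order `3`" is automatic at `dim T(X)_ℚ ≤ 7`, Prop. 2.11 with Kitaoka). [cite: Varesco2023, Thm. 0.2, Thm. 2.1 and Prop. 2.11]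
[cite: Kitaoka1993, Ch. 4 Cor. 4.1.4] [cite: Buskin2019, Thm. 1.1] -/
theorem algebraic_of_similitude_three_of_fifteen_le (hB : Buskin2019_hodgeIsometry_algebraic)
    (hQ3 : Varesco2023_quotientSimilitude_three_of_transcendental_embedding) (hS : IsK3Surface S)
    (η : complexBetti S (2 * 1) ≃ₗ[ℂ] (K3Index → ℂ)) (p : complexBetti S (2 * 2)) (x : K3Index → ℂ)
    (hM : MarkedK3[S, η, p, x]) (hρ : 15 ≤ Module.finrank ℂ ↥(algebraicClasses S 1))
    {Y : SchemeOver ℂ} (hY : IsK3Surface Y)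
    (ηY : complexBetti Y (2 * 1) ≃ₗ[ℂ] (K3Index → ℂ)) (pY : complexBetti Y (2 * 2)) (xY : K3Index → ℂ)
    (hMY : MarkedK3[Y, ηY, pY, xY])
    (ψ : complexBetti Y (2 * 1) →ₗ[ℂ] complexBetti S (2 * 1))
    (hψT : ∀ y ∈ transcendentalSubspace Y, ψ y ∈ transcendentalSubspace S)
    (hψonto : ∀ z ∈ transcendentalSubspace S, ∃ y ∈ transcendentalSubspace Y, ψ y = z)
    (hψrat : ∀ y ∈ transcendentalSubspace Y, IsRationalClass y → IsRationalClass (ψ y))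
    (hψmul : ∀ a ∈ transcendentalSubspace Y, ∀ b ∈ transcendentalSubspace Y,
      k3Form (η (ψ a)) (η (ψ b)) = 3 * k3Form (ηY a) (ηY b))
    (hψline : ∃ t : ℂ, ψ (ηY.symm xY) = t • η.symm x) :
    ∃ γ' ∈ algebraicClasses (S ⊗ Y) 2, ∀ y ∈ transcendentalSubspace Y,
      Corr[complexOrientationFamily, S, Y, hS.1, hY.1 ; γ', y] = ψ y := by
  obtain ⟨hp₀, ⟨hpint, hpgen, hηint, hηcup, -, -⟩, -⟩ := id hM
  obtain ⟨ι, hiso, hinj⟩ := NikulinIsogeny.exists_transcendentalEmbedding_weightedSumSquares hS η p x hM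
    (![1, 1, 1, -1, -1, -1, -2, -6, -2, -6] : Fin 10 → ℚ) NikulinIsogeny.u3a2Weights_ne_zero
    (by rw [NikulinIsogeny.ncard_u3a2Weights_pos]) (by rw [NikulinIsogeny.ncard_u3a2Weights_neg]; omega)
    (by omega)
  obtain ⟨Z, hZ, ηZ, pZ, xZ, hMZ, φ, γ, hγalg, hφ, hφrat, hφtyp, hφT, hφonto, hφmul⟩ :=
    hQ3 hS η p hp₀ hpint hpgen hηint hηcup ι hiso hinj
  refine algebraic_of_similitude_of_datum hB hS η p x hM hY ηY pY xY hMY hZ ηZ pZ xZ hMZ (m := 3) three_ne_zero γ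
    ⟨hγalg, fun y hy ↦ by rw [← hφ]; exact hφrat y hy, fun i j y hy ↦ by rw [← hφ]; exact hφtyp i j y hy,
      fun y hy ↦ by rw [← hφ]; exact hφT y hy,
      fun z hz ↦ by
        obtain ⟨y, hy, hyz⟩ := hφonto z hz
        exact ⟨y, hy, by rw [← hφ]; exact hyz⟩,
      fun a ha b hb ↦ by rw [← hφ, ← hφ, Nat.cast_ofNat]; exact hφmul a ha b hb⟩
    ψ hψT hψonto hψrat (fun a ha b hb ↦ by rw [Nat.cast_ofNat]; exact hψmul a ha b hb) hψline

end Summit.HodgeConjecture.HodgeConjecture.Theorems.MarkmanPartnerTransport.QuotientSimilitude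

end
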